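import Mathlib
import Summits.ValiantsHypothesis.ValiantsHypothesis.Theorems.ContractivityPricePriceOfContractivityStubFewVars
import HarnessLib

/-!
# Crux `PriceOfContractivity` (stmt-ValiantsHypothesis-10583), line `registered` (birth rev 15) —
# stub `stub_budgetOfContractivity_fewVars` (UNCONDITIONAL: the crux up to a quasi-polynomial norm
# budget, for `N ≤ 2 log₂(m+N) + 3` variables)

Route `ValiantsHypothesis/ContractivityPrice`, crux K1 (`…Theses.ContractivityPrice.PriceOfContractivity`):
a polynomial `p` over `ℂ` in `≤ N` variables with an affine determinantal representation of size `m`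
and no zero on the CLOSED polydisc of radius `2` has a contractive Sylvester realization
`p = p(0) · det (1 + diag (X ∘ κ) · K)`, `‖K‖_op ≤ 1`, of size `R ≤ 2 ^ ((log₂ (m + N) + d) ^ d)`.
The lead's skeleton (line `birth`, rev 15) splits it into a "balanced budget" step (quasi-polynomial
SIZE and quasi-polynomial NORM) and a "norm halving" step (NH₁, open).  Theorem A″
(`FewColours.stub_stableLifting_fewColours`, landed) together with the landed cycle-mean bound and
max-plus balancing (`FewVars.balancedBudget_fewColours`) makes the budget step UNCONDITIONAL for
colourings with at most `L + 1` colours; for inputs with `N ≤ 2 log₂ (m + N) + 3` variables this is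
automatic (the Sylvester normal form `FewVars.normalForm_of_hasDetRepr` colours with `≤ #σ ≤ N`
colours and `L := 2 log₂ (m + N) + 2`).  The registered stub `stub_budgetOfContractivity_fewVars`
states exactly this: the crux's conclusion with `‖K‖ ≤ 1` replaced by the budget
`‖K‖ ≤ 2 ^ ((log₂ (m + N) + d) ^ d)`, unconditionally.  Its proof is the first half of the landed
`FewVars.stub_priceOfContractivity_fewVars` (normal form → few-colours balanced budget) followed by
the exponent arithmetic `(2ℓ + 2 + d')^d' ≤ (ℓ + (2d' + 4))^(2d' + 4)` (`exponent_bound₄`).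
No definitions; pure theorem file.  References: folklore (Sylvester pencils, diagonal similarity).
-/

noncomputable section

-- `Summit.<Summit>.<Problem>` repeats `ValiantsHypothesis` by the tree's layout convention (D-0017).
set_option linter.dupNamespace false

namespace Summit.ValiantsHypothesis.ValiantsHypothesis.Theorems.PriceOfContractivity.FewVarsBudget

open MvPolynomial Matrix
open Literature.Computability.AlgebraicComplexity
open Summit.ValiantsHypothesis.ValiantsHypothesis.Theorems.PriceOfContractivity

/-! ### §1 The exponent arithmetic -/

/-- The exponent arithmetic of the budget step: with `L = 2ℓ + 2` and the absolute exponent `d` of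
the few-colours balanced budget, `(L + d) ^ d ≤ (ℓ + (2d + 4)) ^ (2d + 4)`
(`2ℓ + 2 + d ≤ 2v ≤ v²` for `v = ℓ + d + 2 ≥ 2`). -/
theorem exponent_bound₄ (d ℓ : ℕ) :
    (2 * ℓ + 2 + d) ^ d ≤ (ℓ + (2 * d + 4)) ^ (2 * d + 4) := by
  have hv2 : 2 ≤ ℓ + d + 2 := by omega
  calc (2 * ℓ + 2 + d) ^ d ≤ (2 * (ℓ + d + 2)) ^ d := Nat.pow_le_pow_left (by omega) d
    _ ≤ ((ℓ + d + 2) * (ℓ + d + 2)) ^ d := Nat.pow_le_pow_left (Nat.mul_le_mul_right _ hv2) d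
    _ = (ℓ + d + 2) ^ (2 * d) := by rw [pow_mul, pow_two]
    _ ≤ (ℓ + (2 * d + 4)) ^ (2 * d) := Nat.pow_le_pow_left (by omega) _
    _ ≤ (ℓ + (2 * d + 4)) ^ (2 * d + 4) := Nat.pow_le_pow_right (by omega) (by omega)

/-! ### §2 The registered stub -/

/-- **Unconditional partial case of the crux up to a norm budget: `N ≤ 2 log₂(m+N) + 3` variables.**
For such inputs the Sylvester normal form (`FewVars.normalForm_of_hasDetRepr`: `R ≤ #σ · m ≤ 2 ^ L`,
`L = 2 log₂(m+N) + 2`) uses `≤ #σ ≤ N ≤ L + 1` colours, so Theorem A″ with the landed cycle-mean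
bound and balancing (`FewVars.balancedBudget_fewColours`) gives a realization of quasi-polynomial
SIZE and quasi-polynomial NORM BUDGET `R₁, ‖K₁‖ ≤ 2 ^ ((L + d')^d') ≤ 2 ^ ((log₂(m+N) + d)^d)`,
`d = 2d' + 4` (`exponent_bound₄`). [folklore] (The first half of the landed
`FewVars.stub_priceOfContractivity_fewVars`, adapted.) -/
theorem stub_budgetOfContractivity_fewVars :
    ∃ d : ℕ, ∀ (N m : ℕ) {σ : Type} [Fintype σ] (p : MvPolynomial σ ℂ), Fintype.card σ ≤ N →
      N ≤ 2 * Nat.log 2 (m + N) + 3 →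
      Literature.Computability.AlgebraicComplexity.HasDetRepr p m →
      (∀ z : σ → ℂ, (∀ j, ‖z j‖ ≤ 2) → MvPolynomial.eval z p ≠ 0) →
      ∃ R ≤ 2 ^ ((Nat.log 2 (m + N) + d) ^ d), ∃ (K : Matrix (Fin R) (Fin R) ℂ) (κ : Fin R → σ),
        ‖Matrix.toEuclideanCLM (𝕜 := ℂ) K‖ ≤ (2 : ℝ) ^ ((Nat.log 2 (m + N) + d) ^ d) ∧
        p = MvPolynomial.C (MvPolynomial.eval 0 p) *
          (1 + Matrix.diagonal (fun i => MvPolynomial.X (κ i)) * K.map (fun a : ℂ => (MvPolynomial.C a : MvPolynomial σ ℂ))).det := by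
  -- the balanced budget for at most `L + 1` colours (Theorem A″ + cycle-mean bound + balancing)
  obtain ⟨d, hd⟩ := FewVars.balancedBudget_fewColours
  refine ⟨2 * d + 4, ?_⟩
  intro N m σ _ p hσ hN hrep hzero
  -- `p(0) ≠ 0` (zero-freeness at the centre)
  have hp0 : MvPolynomial.eval 0 p ≠ 0 :=
    hzero 0 (fun j => by simp only [Pi.zero_apply, norm_zero]; norm_num)
  -- Sylvester normal form
  obtain ⟨R, hR, K₀, κ, hnf⟩ := FewVars.normalForm_of_hasDetRepr hrep hp0
  -- the pencil inherits zero-freeness on the closed radius-2 polydisc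
  have hz₀ : (∀ z : σ → ℂ, (∀ j, ‖z j‖ ≤ 2) → MvPolynomial.eval z (1 + Matrix.diagonal (fun i => MvPolynomial.X (κ i)) * K₀.map (fun a : ℂ => (MvPolynomial.C a : MvPolynomial σ ℂ))).det ≠ 0) :=
    fun z hz h => hzero z hz (by rw [hnf, map_mul, h, mul_zero])
  -- bit length of the size: `R ≤ N·m ≤ (m+N)² ≤ 2 ^ L`, `L = 2 log₂(m+N) + 2`
  have hlog : m + N < 2 ^ (Nat.log 2 (m + N) + 1) := Nat.lt_pow_succ_log_self one_lt_two _
  have hRL : R ≤ 2 ^ (2 * Nat.log 2 (m + N) + 2) := by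
    calc R ≤ Fintype.card σ * m := hR
      _ ≤ (m + N) * (m + N) :=
          Nat.mul_le_mul (hσ.trans (Nat.le_add_left N m)) (Nat.le_add_right m N)
      _ ≤ 2 ^ (Nat.log 2 (m + N) + 1) * 2 ^ (Nat.log 2 (m + N) + 1) := Nat.mul_le_mul hlog.le hlog.le
      _ = 2 ^ (2 * Nat.log 2 (m + N) + 2) := by rw [← pow_add]; ring_nf
  -- the normal-form colouring uses at most `#σ ≤ N ≤ L + 1` colours
  have hcol : ∃ s : Finset σ, s.card ≤ 2 * Nat.log 2 (m + N) + 2 + 1 ∧ ∀ i, κ i ∈ s :=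
    ⟨Finset.univ, by rw [Finset.card_univ]; omega, fun i => Finset.mem_univ _⟩
  -- balanced budget
  obtain ⟨R₁, hR₁, K₁, κ₁, hK₁, hdet₁⟩ := hd (2 * Nat.log 2 (m + N) + 2) R K₀ κ hcol hRL hz₀
  -- exponent arithmetic
  have hexp := exponent_bound₄ d (Nat.log 2 (m + N))
  refine ⟨R₁, hR₁.trans (Nat.pow_le_pow_right two_pos hexp), K₁, κ₁,
    hK₁.trans (pow_le_pow_right₀ one_le_two hexp), hnf.trans (by rw [hdet₁])⟩

end Summit.ValiantsHypothesis.ValiantsHypothesis.Theorems.PriceOfContractivity.FewVarsBudget
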